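import Literature.AlgebraicGeometry.Motives.GaloisThickening
import Literature.AlgebraicGeometry.Motives.IntegralModelOfGlobalModel
import Mathlib.Algebra.Category.Ring.Constructions
import Mathlib.RingTheory.DedekindDomain.IntegralClosure
import Mathlib.RingTheory.Localization.BaseChange
import HarnessLib

/-!
# Restriction of scalars of an integral model along `Spec B → Spec A` («the model over `𝒪_{Fᵢ}` VIEWED over `𝓞 F`»)

Topic `Literature/AlgebraicGeometry/Motives`; namespace `Literature.AlgebraicGeometry.Motives.IntegralModel`.  Plumbing `def`s
(`restrictScalarsLeftIso`, `restrictScalars`, `restrictScalarsRingOfIntegers`) and theorems; no named fact, no instance, no notation,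
no `sorry`.  Cell `hodgecm-mathlib`, P6 «MOD programme», sub-desk P6a, GEN layer (organ «INT-RES», A-p03 (g28); F0P6a-plan (g0)
2026-09-01 «GEO-flavoured generic organs are free game»): the moduli heart's witness is a GLOBAL integral model over `𝓞 F` of the
thickened curve `R_{Fᵢ ∕ F}(M⋆ ⊗_F Fᵢ)` «in print: the fine moduli scheme over `𝒪_{Fᵢ}`, VIEWED over `𝓞 F`» (`Lines/F0_P6a_ModuliDatum`
ED. 2, letter MH); this file is that VIEWING, for any square of rings.  HC_CM is proved only modulo the printed citations until rung 0
closes; nothing here is about HC.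

THE MATHEMATICS ([GortzWedhorn2020] Prop. 4.16, §(4.8); [Hartshorne1977] II Thm. 3.3; [SerreTate1968] §1).  Let

  `A → K`
  `↓   ↓`      be a square of commutative rings with `K`, `L` fields and `L = B ⊗_A K` (Mathlib `Algebra.IsPushout A B K L`;
  `B → L`      e.g. `𝓞 F → F`, `𝓞 Fᵢ → Fᵢ` for number fields `F ⊆ Fᵢ`: `Fᵢ = 𝓞 Fᵢ ⊗_{𝓞 F} F`),

so that `Spec L = Spec B ×_{Spec A} Spec K` (`isPullback_specMap_of_isPushout`).  For a `B`-scheme `M → Spec B` the pasting of the two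
cartesian squares `M ×_B L → Spec L → Spec K` over `M → Spec B → Spec A` shows that `M ×_B L`, with its projection to `M` and the
composite map to `Spec K`, IS the fibre product `(M → Spec B → Spec A) ×_{Spec A} Spec K` (`isPullback_fst_sndCompSpecMap`).  Hence an
integral model `𝓜` over `B` of an `L`-scheme `Z` (`𝓜.total ×_B L ≅ Z`) restricts to an integral model over `A` of the `K`-scheme
`Z → Spec L → Spec K` (the tree's `SchemeOver.restrictScalars K Z`; at `Z = X ⊗_K L` this is the Galois thickening `(thickening K L).obj X`
BY `rfl`, ★ `thickening_obj_eq_restrictScalars`): total space `𝓜.total → Spec B → Spec A`, generic isomorphism = pasting iso then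
`𝓜.genericIso` (`restrictScalars`).  The structure morphism of the restricted model is the COMPOSITE `𝓜.total.hom ≫ (Spec B → Spec A)`, so
quasi-compactness, quasi-separatedness, local finite presentation, flatness, separatedness, properness pass to it from the two factors
(§3; Mathlib's stability-under-composition instances) — at `𝓞 F → 𝓞 Fᵢ` the second factor is FINITE, FLAT and FINITELY PRESENTED
(`𝓞 Fᵢ` is a finite torsion-free, hence flat, module over the Dedekind domain `𝓞 F`), §4.

MAIN STATEMENTS.  §1 `isPullback_specMap_of_isPushout`, `isPullback_fst_sndCompSpecMap`; §2 `restrictScalarsLeftIso` (def) +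
`restrictScalarsLeftIso_hom_fst` ∕ `_hom_snd` ∕ `_inv_fst`, **`restrictScalars`** (def), `restrictScalars_total`, `restrictScalars_total_hom`,
`restrictScalars_genericIso_hom_left`, **`restrictScalars_genericIso_hom_left_comp`** (the generic isomorphism of the restriction followed by
`𝓜.genericIso⁻¹` and the projection to `𝓜.total` is the projection of `(𝓜.total∕A) ×_A K`); §3 `quasiCompact_` ∕ `quasiSeparated_` ∕
`locallyOfFinitePresentation_` ∕ `flat_` ∕ `isSeparated_` ∕ `universallyClosed_` ∕ `isProper_restrictScalars_total_hom`; §4 (number fields `F ⊆ Fᵢ`)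
`flat_specMap_ringOfIntegers`, `isFinite_specMap_ringOfIntegers`, `locallyOfFinitePresentation_specMap_ringOfIntegers`,
**`restrictScalarsRingOfIntegers (𝓜 : IntegralModel (𝓞 Fᵢ) Fᵢ Z) : IntegralModel (𝓞 F) F (SchemeOver.restrictScalars F Z)`** (def; at
`Z = (baseChange F Fᵢ).obj X` the target is `IntegralModel (𝓞 F) F ((thickening F Fᵢ).obj X)` on the nose), `restrictScalarsRingOfIntegers_total_hom`,
and the five EQV-SPREAD binders `quasiCompact_` ∕ `quasiSeparated_` ∕ `locallyOfFinitePresentation_` ∕ `flat_` ∕ `isSeparated_restrictScalarsRingOfIntegers`.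
NOT here: points ∕ sheets of the restricted model (integral `thickeningPointsEquiv`), localisation-away bases `𝓞 Fᵢ[1∕N]` (the generic §§1–3
apply verbatim to `B = 𝓞 Fᵢ[1∕N]` once `Algebra.IsPushout (𝓞 F) B F Fᵢ` is supplied).

## References
* [GortzWedhorn2020] U. Görtz, T. Wedhorn, *Algebraic Geometry I* (2nd ed.), Prop. 4.16 and §(4.8) (transitivity of fibre products; an
  `S′`-scheme regarded as an `S`-scheme).
* [Hartshorne1977] R. Hartshorne, *Algebraic Geometry*, II Thm. 3.3 (p. 87) (fibre products; `Spec B ×_{Spec A} Spec K = Spec (B ⊗_A K)`).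
* [SerreTate1968] J.-P. Serre, J. Tate, *Good reduction of abelian varieties*, Ann. of Math. 88 (1968), §1 (models).
-/

set_option autoImplicit false

noncomputable section

set_option backward.isDefEq.respectTransparency false

open CategoryTheory CategoryTheory.Limits AlgebraicGeometry
open scoped NumberField

namespace Literature.AlgebraicGeometry.Motives.IntegralModel

/-! ## §1 The cartesian square `Spec L = Spec B ×_{Spec A} Spec K` and its pasting with a `B`-scheme -/

section Square

variable {A K B L : Type} [CommRing A] [Field K] [Algebra A K] [CommRing B] [Field L] [Algebra B L]
  [Algebra A B] [Algebra K L] [Algebra A L] [IsScalarTower A B L] [IsScalarTower A K L]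

/-- **`Spec L = Spec B ×_{Spec A} Spec K`** when `L = B ⊗_A K` (Mathlib `Algebra.IsPushout A B K L`): the square of spectra of a pushout
square of rings is cartesian (Mathlib `isPullback_SpecMap_of_isPushout`). [cite: Hartshorne1977, II Thm. 3.3 (p. 87)] -/
theorem isPullback_specMap_of_isPushout [h : Algebra.IsPushout A B K L] :
    IsPullback (Spec.map (CommRingCat.ofHom (algebraMap B L))) (Spec.map (CommRingCat.ofHom (algebraMap K L)))
      (Spec.map (CommRingCat.ofHom (algebraMap A B))) (Spec.map (CommRingCat.ofHom (algebraMap A K))) :=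
  isPullback_SpecMap_of_isPushout _ _ _ _ ((CommRingCat.isPushout_iff_isPushout ..).mpr h)

/-- **Pasting**: for a `B`-scheme `p : M → Spec B` and `L = B ⊗_A K`, the base change `M ×_B L` with its first projection to `M` and the
composite `M ×_B L → Spec L → Spec K` IS the fibre product of `M → Spec B → Spec A` with `Spec K → Spec A` (vertical pasting of the
cartesian squares `M ×_B L → Spec L` over `M → Spec B` and `Spec L → Spec K` over `Spec B → Spec A`).
[cite: GortzWedhorn2020, Prop. 4.16 and §(4.8)] -/
theorem isPullback_fst_sndCompSpecMap [Algebra.IsPushout A B K L] {M : Scheme} (p : M ⟶ Spec (.of B)) :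
    IsPullback (pullback.fst p (Spec.map (CommRingCat.ofHom (algebraMap B L))))
      (pullback.snd p (Spec.map (CommRingCat.ofHom (algebraMap B L))) ≫ Spec.map (CommRingCat.ofHom (algebraMap K L)))
      (p ≫ Spec.map (CommRingCat.ofHom (algebraMap A B))) (Spec.map (CommRingCat.ofHom (algebraMap A K))) :=
  (IsPullback.of_hasPullback p _).paste_vert isPullback_specMap_of_isPushout

end Square

/-! ## §2 Restriction of scalars of an integral model -/

section Restrict

variable {A K B L : Type} [CommRing A] [Field K] [Algebra A K] [CommRing B] [Field L] [Algebra B L]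
  [Algebra A B] [Algebra K L] [Algebra A L] [IsScalarTower A B L] [IsScalarTower A K L] [Algebra.IsPushout A B K L]
  {Z : SchemeOver L}

/-- The underlying-scheme isomorphism `(𝓜.total∕A) ×_A K ≅ 𝓜.total ×_B L` between the generic fibre of the model VIEWED over `A` and the
generic fibre of the model over `B` (the pasting `isPullback_fst_sndCompSpecMap`, Mathlib `IsPullback.isoPullback`). [folklore] -/
def restrictScalarsLeftIso (𝓜 : IntegralModel B L Z) :
    ((baseChange A K).obj (SchemeOver.restrictScalars A 𝓜.total)).left ≅ ((baseChange B L).obj 𝓜.total).left :=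
  (isPullback_fst_sndCompSpecMap (A := A) (K := K) 𝓜.total.hom).isoPullback.symm

/-- `restrictScalarsLeftIso` against the first projections to `𝓜.total`. [cite: GortzWedhorn2020, Prop. 4.16 and §(4.8)] -/
@[reassoc]
theorem restrictScalarsLeftIso_hom_fst (𝓜 : IntegralModel B L Z) :
    (restrictScalarsLeftIso (A := A) (K := K) 𝓜).hom ≫ pullback.fst 𝓜.total.hom (Spec.map (CommRingCat.ofHom (algebraMap B L))) =
      pullback.fst (𝓜.total.hom ≫ Spec.map (CommRingCat.ofHom (algebraMap A B))) (Spec.map (CommRingCat.ofHom (algebraMap A K))) :=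
  (isPullback_fst_sndCompSpecMap (A := A) (K := K) 𝓜.total.hom).isoPullback_inv_fst

/-- `restrictScalarsLeftIso` against the structure maps to `Spec K`. [cite: GortzWedhorn2020, Prop. 4.16 and §(4.8)] -/
@[reassoc]
theorem restrictScalarsLeftIso_hom_snd (𝓜 : IntegralModel B L Z) :
    (restrictScalarsLeftIso (A := A) (K := K) 𝓜).hom ≫ pullback.snd 𝓜.total.hom (Spec.map (CommRingCat.ofHom (algebraMap B L))) ≫
        Spec.map (CommRingCat.ofHom (algebraMap K L)) =
      pullback.snd (𝓜.total.hom ≫ Spec.map (CommRingCat.ofHom (algebraMap A B))) (Spec.map (CommRingCat.ofHom (algebraMap A K))) :=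
  (isPullback_fst_sndCompSpecMap (A := A) (K := K) 𝓜.total.hom).isoPullback_inv_snd

/-- The inverse of `restrictScalarsLeftIso` against the first projections. [cite: GortzWedhorn2020, Prop. 4.16 and §(4.8)] -/
@[reassoc]
theorem restrictScalarsLeftIso_inv_fst (𝓜 : IntegralModel B L Z) :
    (restrictScalarsLeftIso (A := A) (K := K) 𝓜).inv ≫
        pullback.fst (𝓜.total.hom ≫ Spec.map (CommRingCat.ofHom (algebraMap A B))) (Spec.map (CommRingCat.ofHom (algebraMap A K))) =
      pullback.fst 𝓜.total.hom (Spec.map (CommRingCat.ofHom (algebraMap B L))) :=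
  (isPullback_fst_sndCompSpecMap (A := A) (K := K) 𝓜.total.hom).isoPullback_hom_fst

/-- **Restriction of scalars of an integral model** along the square `A → K`, `B → L` (`L = B ⊗_A K`): an integral model `𝓜` over
`B` of the `L`-scheme `Z` gives the integral model over `A` of `Z` REGARDED over `K` (`SchemeOver.restrictScalars K Z`; for `Z = X ⊗_K L`
this is `(thickening K L).obj X` by `rfl`) whose total space is `𝓜.total → Spec B → Spec A` and whose generic isomorphism is the pasting
isomorphism `(𝓜.total∕A) ×_A K ≅ 𝓜.total ×_B L` followed by `𝓜.genericIso` («the model over `𝒪_{Fᵢ}`, viewed over `𝓞 F`»).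
[cite: SerreTate1968, §1] -/
def restrictScalars (𝓜 : IntegralModel B L Z) : IntegralModel A K (SchemeOver.restrictScalars K Z) where
  total := SchemeOver.restrictScalars A 𝓜.total
  genericIso := Over.isoMk (restrictScalarsLeftIso (A := A) (K := K) 𝓜 ≪≫ (Over.forget _).mapIso 𝓜.genericIso) (by
    change ((restrictScalarsLeftIso (A := A) (K := K) 𝓜).hom ≫ 𝓜.genericIso.hom.left) ≫ Z.hom ≫
        Spec.map (CommRingCat.ofHom (algebraMap K L)) =
      pullback.snd (𝓜.total.hom ≫ Spec.map (CommRingCat.ofHom (algebraMap A B))) (Spec.map (CommRingCat.ofHom (algebraMap A K)))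
    rw [Category.assoc, ← Category.assoc 𝓜.genericIso.hom.left, Over.w 𝓜.genericIso.hom]
    exact restrictScalarsLeftIso_hom_snd (A := A) (K := K) 𝓜)

/-- The total space of the restriction is `𝓜.total` regarded over `A`. [cite: SerreTate1968, §1] -/
theorem restrictScalars_total (𝓜 : IntegralModel B L Z) :
    (restrictScalars (A := A) (K := K) 𝓜).total = SchemeOver.restrictScalars A 𝓜.total := rfl

/-- The structure morphism of the restriction is the COMPOSITE `𝓜.total → Spec B → Spec A`. [cite: GortzWedhorn2020, Prop. 4.16 and §(4.8)] -/
theorem restrictScalars_total_hom (𝓜 : IntegralModel B L Z) :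
    (restrictScalars (A := A) (K := K) 𝓜).total.hom = 𝓜.total.hom ≫ Spec.map (CommRingCat.ofHom (algebraMap A B)) := rfl

/-- The underlying scheme of the total space is unchanged. [cite: GortzWedhorn2020, Prop. 4.16 and §(4.8)] -/
theorem restrictScalars_total_left (𝓜 : IntegralModel B L Z) : (restrictScalars (A := A) (K := K) 𝓜).total.left = 𝓜.total.left := rfl

/-- The generic isomorphism of the restriction on underlying schemes: pasting iso, then `𝓜.genericIso`. [cite: SerreTate1968, §1] -/
theorem restrictScalars_genericIso_hom_left (𝓜 : IntegralModel B L Z) :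
    (restrictScalars (A := A) (K := K) 𝓜).genericIso.hom.left =
      (restrictScalarsLeftIso (A := A) (K := K) 𝓜).hom ≫ 𝓜.genericIso.hom.left := rfl

/-- **Compatibility of the two generic isomorphisms with the projections to `𝓜.total`**: reading a point of the generic fibre of the
restricted model in `Z` and then in `𝓜.total ×_B L` (through `𝓜.genericIso⁻¹`) and projecting to `𝓜.total` is the first projection of
`(𝓜.total∕A) ×_A K`. [cite: GortzWedhorn2020, Prop. 4.16 and §(4.8)] -/
theorem restrictScalars_genericIso_hom_left_comp (𝓜 : IntegralModel B L Z) :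
    (restrictScalars (A := A) (K := K) 𝓜).genericIso.hom.left ≫ 𝓜.genericIso.inv.left ≫
        pullback.fst 𝓜.total.hom (Spec.map (CommRingCat.ofHom (algebraMap B L))) =
      pullback.fst (𝓜.total.hom ≫ Spec.map (CommRingCat.ofHom (algebraMap A B))) (Spec.map (CommRingCat.ofHom (algebraMap A K))) := by
  rw [restrictScalars_genericIso_hom_left, Category.assoc, ← Over.comp_left_assoc, Iso.hom_inv_id, Over.id_left, Category.id_comp,
    restrictScalarsLeftIso_hom_fst]

end Restrict

/-! ## §3 Properties of the structure morphism inherited by the restriction (composition) -/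

section Properties

variable {A K B L : Type} [CommRing A] [Field K] [Algebra A K] [CommRing B] [Field L] [Algebra B L]
  [Algebra A B] [Algebra K L] [Algebra A L] [IsScalarTower A B L] [IsScalarTower A K L] [Algebra.IsPushout A B K L]
  {Z : SchemeOver L} (𝓜 : IntegralModel B L Z)

/-- Quasi-compact over `A` if quasi-compact over `B` and `Spec B → Spec A` is. [cite: GortzWedhorn2020, Prop. 4.16 and §(4.8)] -/
theorem quasiCompact_restrictScalars_total_hom [QuasiCompact 𝓜.total.hom]
    [QuasiCompact (Spec.map (CommRingCat.ofHom (algebraMap A B)))] :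
    QuasiCompact (restrictScalars (A := A) (K := K) 𝓜).total.hom := by
  rw [restrictScalars_total_hom]; infer_instance

/-- Quasi-separated over `A` if quasi-separated over `B` and `Spec B → Spec A` is. [cite: GortzWedhorn2020, Prop. 4.16 and §(4.8)] -/
theorem quasiSeparated_restrictScalars_total_hom [QuasiSeparated 𝓜.total.hom]
    [QuasiSeparated (Spec.map (CommRingCat.ofHom (algebraMap A B)))] :
    QuasiSeparated (restrictScalars (A := A) (K := K) 𝓜).total.hom := by
  rw [restrictScalars_total_hom]; infer_instance

/-- Locally of finite presentation over `A` if so over `B` and `Spec B → Spec A` is. [cite: GortzWedhorn2020, Prop. 4.16 and §(4.8)] -/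
theorem locallyOfFinitePresentation_restrictScalars_total_hom [LocallyOfFinitePresentation 𝓜.total.hom]
    [LocallyOfFinitePresentation (Spec.map (CommRingCat.ofHom (algebraMap A B)))] :
    LocallyOfFinitePresentation (restrictScalars (A := A) (K := K) 𝓜).total.hom := by
  rw [restrictScalars_total_hom]; infer_instance

/-- Flat over `A` if flat over `B` and `Spec B → Spec A` is flat. [cite: GortzWedhorn2020, Prop. 4.16 and §(4.8)] -/
theorem flat_restrictScalars_total_hom [Flat 𝓜.total.hom] [Flat (Spec.map (CommRingCat.ofHom (algebraMap A B)))] :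
    Flat (restrictScalars (A := A) (K := K) 𝓜).total.hom := by
  rw [restrictScalars_total_hom]; infer_instance

/-- Separated over `A` if separated over `B` (`Spec B → Spec A` is affine, hence separated). [cite: GortzWedhorn2020, Prop. 4.16 and §(4.8)] -/
theorem isSeparated_restrictScalars_total_hom [IsSeparated 𝓜.total.hom] :
    IsSeparated (restrictScalars (A := A) (K := K) 𝓜).total.hom := by
  rw [restrictScalars_total_hom]; infer_instance

/-- Universally closed over `A` if so over `B` and `Spec B → Spec A` is. [cite: GortzWedhorn2020, Prop. 4.16 and §(4.8)] -/
theorem universallyClosed_restrictScalars_total_hom [UniversallyClosed 𝓜.total.hom]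
    [UniversallyClosed (Spec.map (CommRingCat.ofHom (algebraMap A B)))] :
    UniversallyClosed (restrictScalars (A := A) (K := K) 𝓜).total.hom := by
  rw [restrictScalars_total_hom]; infer_instance

/-- Proper over `A` if proper over `B` and `Spec B → Spec A` is proper (e.g. finite). [cite: GortzWedhorn2020, Prop. 4.16 and §(4.8)] -/
theorem isProper_restrictScalars_total_hom [IsProper 𝓜.total.hom] [IsProper (Spec.map (CommRingCat.ofHom (algebraMap A B)))] :
    IsProper (restrictScalars (A := A) (K := K) 𝓜).total.hom := by
  rw [restrictScalars_total_hom]; infer_instance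

end Properties

/-! ## §4 Number fields `F ⊆ Fᵢ`: the model over `𝓞 Fᵢ` viewed over `𝓞 F` -/

section NumberField

variable {F Fi : Type} [Field F] [NumberField F] [Field Fi] [NumberField Fi] [Algebra F Fi]

/-- `Fᵢ = 𝓞 Fᵢ ⊗_{𝓞 F} F`: every element of `Fᵢ` is an `𝓞 Fᵢ`-element over a nonzero integer of `F` (Mathlib
`IsIntegralClosure.isLocalization_of_isSeparable` + `Algebra.isPushout_of_isLocalization`). [folklore] -/
private theorem isPushout_ringOfIntegers : Algebra.IsPushout (𝓞 F) (𝓞 Fi) F Fi :=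
  haveI : IsLocalization (Algebra.algebraMapSubmonoid (𝓞 Fi) (nonZeroDivisors (𝓞 F))) Fi :=
    IsIntegralClosure.isLocalization_of_isSeparable (𝓞 F) F Fi (𝓞 Fi)
  Algebra.isPushout_of_isLocalization (nonZeroDivisors (𝓞 F)) F (𝓞 Fi) Fi

omit [NumberField Fi] in
/-- `Spec 𝓞 Fᵢ → Spec 𝓞 F` is FLAT: `𝓞 Fᵢ` is torsion-free over the Dedekind domain `𝓞 F`, hence flat (Mathlib `Module.Flat` instance).
[cite: SerreTate1968, §1] -/
theorem flat_specMap_ringOfIntegers : Flat (Spec.map (CommRingCat.ofHom (algebraMap (𝓞 F) (𝓞 Fi)))) := by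
  rw [HasRingHomProperty.Spec_iff (P := @Flat)]
  exact RingHom.flat_algebraMap_iff.mpr inferInstance

/-- `Spec 𝓞 Fᵢ → Spec 𝓞 F` is FINITE (`𝓞 Fᵢ` is a finite `𝓞 F`-module). [cite: SerreTate1968, §1] -/
theorem isFinite_specMap_ringOfIntegers : IsFinite (Spec.map (CommRingCat.ofHom (algebraMap (𝓞 F) (𝓞 Fi)))) := by
  rw [IsFinite.SpecMap_iff]
  exact RingHom.finite_algebraMap.mpr inferInstance

/-- `Spec 𝓞 Fᵢ → Spec 𝓞 F` is LOCALLY OF FINITE PRESENTATION (a finite algebra over a Noetherian ring is finitely presented).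
[cite: SerreTate1968, §1] -/
theorem locallyOfFinitePresentation_specMap_ringOfIntegers :
    LocallyOfFinitePresentation (Spec.map (CommRingCat.ofHom (algebraMap (𝓞 F) (𝓞 Fi)))) := by
  rw [HasRingHomProperty.Spec_iff (P := @LocallyOfFinitePresentation)]
  haveI : Algebra.FinitePresentation (𝓞 F) (𝓞 Fi) := (Algebra.FinitePresentation.of_finiteType).mp inferInstance
  exact RingHom.finitePresentation_algebraMap.mpr inferInstance

variable {Z : SchemeOver Fi}

/-- **The model over `𝓞 Fᵢ`, VIEWED over `𝓞 F`**: restriction of scalars of an integral model of an `Fᵢ`-scheme `Z` over `𝓞 Fᵢ` to an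
integral model over `𝓞 F` of `Z` regarded over `F` (`SchemeOver.restrictScalars F Z`; for `Z = X ⊗_F Fᵢ` this is LITERALLY
`IntegralModel (𝓞 F) F ((thickening F Fᵢ).obj X)`, ★ `thickening_obj_eq_restrictScalars`) — the square `𝓞 F → F`, `𝓞 Fᵢ → Fᵢ` being a
pushout (`Fᵢ = 𝓞 Fᵢ ⊗_{𝓞 F} F`). [cite: SerreTate1968, §1] -/
def restrictScalarsRingOfIntegers (𝓜 : IntegralModel (𝓞 Fi) Fi Z) : IntegralModel (𝓞 F) F (SchemeOver.restrictScalars F Z) :=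
  haveI := isPushout_ringOfIntegers (F := F) (Fi := Fi)
  restrictScalars (A := 𝓞 F) (K := F) 𝓜

/-- `restrictScalarsRingOfIntegers` is `restrictScalars` at the square `𝓞 F → F`, `𝓞 Fᵢ → Fᵢ`. [cite: SerreTate1968, §1] -/
theorem restrictScalarsRingOfIntegers_eq (𝓜 : IntegralModel (𝓞 Fi) Fi Z) :
    haveI := isPushout_ringOfIntegers (F := F) (Fi := Fi)
    restrictScalarsRingOfIntegers (F := F) 𝓜 = restrictScalars (A := 𝓞 F) (K := F) 𝓜 := rfl

/-- Its structure morphism is `𝓜.total → Spec 𝓞 Fᵢ → Spec 𝓞 F`. [cite: GortzWedhorn2020, Prop. 4.16 and §(4.8)] -/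
theorem restrictScalarsRingOfIntegers_total_hom (𝓜 : IntegralModel (𝓞 Fi) Fi Z) :
    (restrictScalarsRingOfIntegers (F := F) 𝓜).total.hom =
      𝓜.total.hom ≫ Spec.map (CommRingCat.ofHom (algebraMap (𝓞 F) (𝓞 Fi))) := rfl

/-- EQV-SPREAD binder 1: quasi-compact. [cite: GortzWedhorn2020, Prop. 4.16 and §(4.8)] -/
theorem quasiCompact_restrictScalarsRingOfIntegers (𝓜 : IntegralModel (𝓞 Fi) Fi Z) [QuasiCompact 𝓜.total.hom] :
    QuasiCompact (restrictScalarsRingOfIntegers (F := F) 𝓜).total.hom := by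
  rw [restrictScalarsRingOfIntegers_total_hom]; infer_instance

/-- EQV-SPREAD binder 2: quasi-separated. [cite: GortzWedhorn2020, Prop. 4.16 and §(4.8)] -/
theorem quasiSeparated_restrictScalarsRingOfIntegers (𝓜 : IntegralModel (𝓞 Fi) Fi Z) [QuasiSeparated 𝓜.total.hom] :
    QuasiSeparated (restrictScalarsRingOfIntegers (F := F) 𝓜).total.hom := by
  rw [restrictScalarsRingOfIntegers_total_hom]; infer_instance

/-- EQV-SPREAD binder 3: locally of finite presentation. [cite: GortzWedhorn2020, Prop. 4.16 and §(4.8)] -/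
theorem locallyOfFinitePresentation_restrictScalarsRingOfIntegers (𝓜 : IntegralModel (𝓞 Fi) Fi Z)
    [LocallyOfFinitePresentation 𝓜.total.hom] :
    LocallyOfFinitePresentation (restrictScalarsRingOfIntegers (F := F) 𝓜).total.hom := by
  haveI := locallyOfFinitePresentation_specMap_ringOfIntegers (F := F) (Fi := Fi)
  rw [restrictScalarsRingOfIntegers_total_hom]; infer_instance

/-- EQV-SPREAD binder 4: flat. [cite: SerreTate1968, §1] -/
theorem flat_restrictScalarsRingOfIntegers (𝓜 : IntegralModel (𝓞 Fi) Fi Z) [Flat 𝓜.total.hom] :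
    Flat (restrictScalarsRingOfIntegers (F := F) 𝓜).total.hom := by
  haveI := flat_specMap_ringOfIntegers (F := F) (Fi := Fi)
  rw [restrictScalarsRingOfIntegers_total_hom]; infer_instance

/-- EQV-SPREAD binder 5: separated. [cite: GortzWedhorn2020, Prop. 4.16 and §(4.8)] -/
theorem isSeparated_restrictScalarsRingOfIntegers (𝓜 : IntegralModel (𝓞 Fi) Fi Z) [IsSeparated 𝓜.total.hom] :
    IsSeparated (restrictScalarsRingOfIntegers (F := F) 𝓜).total.hom := by
  rw [restrictScalarsRingOfIntegers_total_hom]; infer_instance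

/-- Properness passes to the restriction (`Spec 𝓞 Fᵢ → Spec 𝓞 F` is finite, hence proper). [cite: SerreTate1968, §1] -/
theorem isProper_restrictScalarsRingOfIntegers (𝓜 : IntegralModel (𝓞 Fi) Fi Z) [IsProper 𝓜.total.hom] :
    IsProper (restrictScalarsRingOfIntegers (F := F) 𝓜).total.hom := by
  haveI := isFinite_specMap_ringOfIntegers (F := F) (Fi := Fi)
  rw [restrictScalarsRingOfIntegers_total_hom]; infer_instance

/-- The generic isomorphism of the viewed model, read against `𝓜`'s: `genericIso′ ≫ 𝓜.genericIso⁻¹ ≫ pr_{𝓜.total} = pr_{𝓜.total}`.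
[cite: GortzWedhorn2020, Prop. 4.16 and §(4.8)] -/
theorem restrictScalarsRingOfIntegers_genericIso_hom_left_comp (𝓜 : IntegralModel (𝓞 Fi) Fi Z) :
    (restrictScalarsRingOfIntegers (F := F) 𝓜).genericIso.hom.left ≫ 𝓜.genericIso.inv.left ≫
        pullback.fst 𝓜.total.hom (Spec.map (CommRingCat.ofHom (algebraMap (𝓞 Fi) Fi))) =
      pullback.fst (𝓜.total.hom ≫ Spec.map (CommRingCat.ofHom (algebraMap (𝓞 F) (𝓞 Fi))))
        (Spec.map (CommRingCat.ofHom (algebraMap (𝓞 F) F))) :=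
  haveI := isPushout_ringOfIntegers (F := F) (Fi := Fi)
  restrictScalars_genericIso_hom_left_comp (A := 𝓞 F) (K := F) 𝓜

end NumberField

end Literature.AlgebraicGeometry.Motives.IntegralModel
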